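import Summits.NavierStokesRegularity.NavierStokesRegularity.Theses.FilamentSkeletonRss
import HarnessLib.Audit

/-!
# Route `FilamentSkeletonRss` · crux `SelectionBoxRJ` (stmt-NavierStokesRegularity-21220) — line `rpi_window_split`

D-0145 ideator line (seat ns-idea-12 g0, lens «oqh», 2026-08-28; the seat holds the crux-write ACL on 21220).
HONEST FRAMING: a typed PLAN for a HYPOTHETICAL two-filament selection box; nothing in this file is a claim about
Navier–Stokes regularity or blow-up, and no summit is proved by a line.

## The cut (rung-shaped, along the lane's window of record — NOT along an action-gap certificate)
`SelectionBoxRJ` = `∃ consts, pos ∧ ∀ Γ ≥ Γ₂, ∃ skeleton, ∀ ops, DefsH → BoxClausesJ ∧ SignLaw` (`selectionBoxRJ_iff`,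
definitional).  This line pins the WITNESS CLASS to the one family that is numerically inhabited and on which the live
lane ns-filament-19175-p1 is landing rungs (R0 `straightSkew_rung` p569595, R1 `modelArc_rung` p586667, R2
`truePartnerArc_exists` p589705, R3⁻ `trueKernel_defect_rung` p595099; SIGMA-SCALING-21220: the in-ball problem is
Γ-independent in σ = s√η units, second-zero onset ξ* = 0.93 ± 0.03 ⇒ Γ-uniform cap on `Rb`):
the `R_π`-COVARIANT CO-ROTATING SKEW-PAIR BOX — `N = 2`, filament 1 at `(p₀,p₁)` = filament 0 at `(p₁,p₀)` rotated by π
about `e₃` (`X p 1 = Rπ ∘ X (swap p) 0`; v4 — v1–v3 locked `X p 1 = Rπ ∘ X p 0` for ALL `p`, which by the sorry-free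
`corner_obstruction` of §2a′ admits no two-coordinate sign law at all; the diagonal is the lane's `R_π` pair), equal circulation weights `γ ≡ 4`, frame speed `α ∈ [3, 22/5]`, tilt cosine
`|⟪X′(c), e₃⟫| ∈ [7/10, 4/5]`, stagnation stretching `w′(c) ∈ [9/5, 13/5]` (the window of lane g5's PLAN-ONLY split
`ball_box_split`, evidence #5 on 21220, whose file this jail cannot read — this skeleton is typed independently from the
parameters in that evidence note and is meant to give the lane's rungs BY-NAME stub targets; credit for the window: lane g5).
* `stub_ballBox_rpiWindow` (size L–XL; filament analysis + certified numerics; the lane's trajectory): Γ-free constants and,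
  for every large Γ, a 2-parameter `C⁰` box of window skeletons satisfying `BoxClausesJ` VERBATIM (exact frame tangency on
  the ball `‖X‖ ≤ Rb√(Γ log Γ)`, unique supercritical zero, Hurwitz normal block, ball-supported weighted injectivity).
* v1's `stub_signLaw_rpiWindow` is now a THEOREM modulo two typed mechanism stubs (v2, critic idea-crit-8 price P1″ —
  «no prover on the sign half until a mechanism is TYPED between Box and SignLaw on the window»):
  * `stub_slipSign_rpiWindow` (size L; SKELETON-ONLY, computable — filament asymptotics + certified quadrature): the
    explicit SLIP–ACCRETION FUNCTIONAL `S_pj := ⟪profileOp(u_X), D̃_pj⟫ / ⟪D_pj, D̃_pj⟫` (profile-equation residual of the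
    skeleton's own Biot–Savart field tested against the Gaussian-weighted accretion mode of filament `j`) has OPPOSITE SIGNS on
    the faces `p_j = 0 / 1` with a Γ-free RELATIVE floor `s₀` (`SlipPattern`: pointwise domination, no suprema);
  * `stub_signResponse_rpiWindow` (size XL; PDE at prefactor level, SIGN ONLY — the analytic stub): given any floor `s₀ > 0`,
    SOME `η > 0` and `Γ₁` make every admissible reduced family (the antecedent of `SignLaw` VERBATIM, `AdmissibleJ`) satisfy
    `0 < B_pj · S_pj` on the faces (a CORE-UNIVERSALITY claim for the sign of the accretion amplitude: the weight `D̃` sits in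
    the core, where `AdmissibleJ` imposes no closeness — stated openly in the stub's docstring, why-it-might-fail (i));
  `signLawRpiWindow_of : SlipSignRpiWindow → SignResponseRpiWindow → SignLawRpiWindow` is sorry-free
  (`B_pj S_pj > 0`, `B_qj S_qj > 0`, `S_pj S_qj < 0 ⟹ B_pj B_qj < 0`).
`SelectionBoxRJ_of : BallBoxRpiWindow → SlipSignRpiWindow → SignResponseRpiWindow → SelectionBoxRJ` is pure logic.

## Why this line, and why it is not the registered seam
`Lines/action_gap_seam_J.lean` (strategist s1 / planner g2; registered today by this seat as a courtesy) cuts the SIGN LAW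
through an O(1) ACTION-GAP CERTIFICATE `GapCert` on the skeleton; lane g4's datum of record (RESULTS-19174-sign.md) says
the `R_π` family's stagnation-section budget is IMPORT-dominated with near-equal aligned/anti-aligned actions
(Γ·|dV| ~ 1–60 at Γ = 1e4), i.e. NO O(1) gap there — the seam must be steered to asymmetric families where no rung lives.
This line keeps the family where the rungs live and states the sign law there WITHOUT an exponent gap: on the `R_π`
family the sign of `B_pj` is decided at PREFACTOR level, so the sign half must be attacked by a
prefactor-level mechanism — TYPED in §2b of this file (v2) after the card's §Mechanisms: (M1) the
`R_π`-odd accretion pairing (the two accretion modes are exchanged by the covariance, `D_p1 = Rπ_* D_{swap p,0}`; for the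
co-rotating pair the box dial `p_j` = normal slip of filament `j` through its stagnation section flips the sign of the
slip–accretion product across the section, an odd quantity whose sign does not need a gap, only non-vanishing on the
faces), (M2) a linear-response (Kelvin-gate type, cf. `Cruxes/TransverseReductionRJ/Lines/kelvin_gate.lean`) reading of
`B_pj` as the projection of the windowed mismatch `U − u_X` on the adjoint accretion mode, signed by the slip direction.
Bears on: LADDER-NS filament rung (route FilamentSkeletonRss, deciding crux 21220; T3 flag PLAN-ONLY wants a REGISTERED
skeleton whose stub the rung work names).  Open questions in print this answers to (lens oqh): backward ROTATED self-similar
solutions are not excluded under the Type-I bound |u| ≤ C/(|x|+√−t) [Bradshaw–Tsai survey arXiv:1802.00038 p.3, l.51–57;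
Tsai, Lectures on NS, Conj. 8.9]; the RDSS Liouville window of Pineau–Vicol 2026 (Thm 1.4, unquantified in C₀) — the route's
profile has C₀ ~ Γ^{3/2} and lives in that window (planner CRUX-NOTES-21220-g2 §4).

## Cheapest falsifier / instrument row
(F1, kills stub 1 on this window) the lane's continuation of the `R_π` datum LEAVES the window before exact ball tangency is
reached Γ-uniformly (instrument: RESULTS-21220-rball / SIGMA-SCALING rows: second stagnation zero onset ξ* = 0.93 ± 0.03 —
if the required `Rb` for clause 12/13 exceeds the cap 0.37, the window box is empty); (F2, kills stub 2) ONE admissible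
reduced family on ONE window skeleton with `B_p0` of the same sign on both faces `p_0 = 0`, `p_0 = 1` (instrument: the
lane's sign sweep RESULTS-19174-sign.md re-run on the J-box with the prefactor-level budget; a same-sign row is a refutation
of `SignLawRpiWindow`, not of the crux — another family may do, and the seam line survives on asymmetric families);
(F2′, v2/v4 — CHEAPER, skeleton-only, kills stub 2a) ONE quadrature sweep of the explicit functional `S_p0` along the dial
`p_0 ∈ [0,1]` at `p_1 ∈ {0, 1/2, 1}` on the covariant box built from the lane's `R_π` datum, Γ = 1e4 … 1e6: same sign at both
ends (at any `p_1`) ⇒ `SlipSignRpiWindow` is dead as typed (instrument N7: the lane's Biot–Savart evaluator + Gauss–Hermite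
quadrature of `⟪profileOp(u_X), D̃⟫`; ≤ 1 kit job; frozen spec `Cruxes/SelectionBoxRJ/PREREG-slip-sweep-21220.md`).

## Costume / shred self-check
Neither stub gives the crux alone: stub 1 has no sign law; stub 2 is a `∀`-statement with no skeleton (vacuous without
stub 1) — and neither mentions `NavierStokesRegularity`.  Two stubs, both ≥ L; the difficulty is split BOX (geometry +
filament analysis, where 44 rung files already live) / SIGN (PDE), not hidden.  No `Disproof.lean` exists for 21220.
The line honours the junk audit of clause 13 (ball support is in `BoxClausesJ` verbatim), the far-field circulation law
that retired stmt-18688 (window skeletons are TILTED: cos ∈ [7/10, 4/5]), and refuter1 g5's structural risk (branch mixing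
of `U` in `p`) bites `stub_signResponse_rpiWindow` exactly as it bites the crux — recorded as its why-it-might-fail.
v3 shred/costume check: three stubs (box L→XL per lane g8's R3-obstruction; slip sign L, skeleton-only; sign response XL);
`SlipSignRpiWindow` alone gives no statement about any PDE unknown, `SignResponseRpiWindow` alone is conditional on the
slip pattern and on a box (and asserts only a sign agreement, never a sign CHANGE), and `SignLaw` is no longer a stub but DERIVED — the sign bookkeeping is discharged in Lean.
-/

set_option linter.dupNamespace false
set_option linter.unusedVariables false

noncomputable section

namespace Summit.NavierStokesRegularity.NavierStokesRegularity.Cruxes.SelectionBoxRJ.RpiWindowSplit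

open scoped BigOperators Topology Manifold Classical MeasureTheory ProbabilityTheory Matrix InnerProductSpace ComplexConjugate ContinuousMap ENNReal
open Filter Set Function TopologicalSpace MeasureTheory
open Literature.NS
open Literature.Analysis.FluidPDE
open Summit.NavierStokesRegularity.NavierStokesRegularity.Theses.FilamentSkeletonRss

/-! ## 1. The crux, cut at its top-level conjunction (texts VERBATIM from the route decl) -/

/-- (verbatim from `Lines/action_gap_seam_J.lean`, planner ns-filament-repair-plan g2) The five defining hypotheses of `SelectionBoxRJ`, bundled. -/
def DefsH (N : ℕ) (Γ : ℝ) (γ : (Fin N → ℝ) → Fin N → ℝ) (α : (Fin N → ℝ) → ℝ) (X : (Fin N → ℝ) → Fin N → ℝ → EuclideanSpace ℝ (Fin 3)) (c : (Fin N → ℝ) → Fin N → ℝ) (u : (Fin N → ℝ)→(Fin N → ℝ → EuclideanSpace ℝ (Fin 3)) → EuclideanSpace ℝ (Fin 3) → EuclideanSpace ℝ (Fin 3)) (v : (Fin N → ℝ) → EuclideanSpace ℝ (Fin 3) → EuclideanSpace ℝ (Fin 3)) (A : (Fin N → ℝ) → Fin N → (EuclideanSpace ℝ (Fin 3) →L[ℝ]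 EuclideanSpace ℝ (Fin 3))) (T : (Fin N → ℝ)→(Fin N → ℝ → EuclideanSpace ℝ (Fin 3)) → Fin N → ℝ → EuclideanSpace ℝ (Fin 3)) (D : (Fin N → ℝ) → Fin N → EuclideanSpace ℝ (Fin 3) → EuclideanSpace ℝ (Fin 3)) : Prop :=
  (∀ p Z y, u p Z y = ∑ k, (Γ*γ p k/(4*Real.pi)) • ∫ σ:ℝ, ((‖y-Z k σ‖^2+1)^(3/2:ℝ))⁻¹ • cross (deriv (Z k) σ) (y-Z k σ)) ∧ (∀ p y, v p y = u p (X p) y+(1/2:ℝ) • y-α p • cross (EuclideanSpace.single 2 1) y) ∧ (∀ p j, A p j = fderiv ℝ (v p) (X p j (c p j))) ∧ (∀ p Z j τ, T p Z j τ = (u p Z (Z j τ)+(1/2:ℝ) • Z j τ-α p • cross (EuclideanSpace.single 2 1) (Z j τ))-(⟪u p Z (Z j τ)+(1/2:ℝ) • Z j τ-α p • cross (EuclideanSpace.single 2 1) (Z j τ), deriv (Z j) τ⟫_ℝ/‖deriv (Z j) τ‖^2) • deriv (Z j) τ) ∧ (∀ p j y, D p j y = (Real.exp (-(⟪y-X p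 j (c p j), deriv (X p j) (c p j)⟫_ℝ)^2)*((1-Real.exp (-(‖y-X p j (c p j)‖^2-⟪y-X p j (c p j), deriv (X p j) (c p j)⟫_ℝ^2)))/(‖y-X p j (c p j)‖^2-⟪y-X p j (c p j), deriv (X p j) (c p j)⟫_ℝ^2))) • cross (deriv (X p j) (c p j)) (y-X p j (c p j)))

/-- (verbatim) `Conj1 ∧ Conj2` of `SelectionBoxRJ`: the K1‴ ball-box clauses. -/
def BoxClausesJ (N : ℕ) (Γ δ ρ K Λ a b cnd Rw Rb cg θ₀ : ℝ) (γ : (Fin N → ℝ) → Fin N → ℝ) (α : (Fin N → ℝ) → ℝ) (X : (Fin N → ℝ) → Fin N → ℝ → EuclideanSpace ℝ (Fin 3)) (w : (Fin N → ℝ) → Fin N → ℝ → ℝ) (c : (Fin N → ℝ) → Fin N → ℝ) (m : (Fin N → ℝ) → Fin N → EuclideanSpace ℝ (Fin 3)) (n : (Fin N → ℝ) → Fin N → EuclideanSpace ℝ (Fin 3)) (v : (Fin N → ℝ) → EuclideanSpace ℝ (Fin 3) → EuclideanSpace ℝ (Fin 3)) (A : (Fin N → ℝ) → Fin N → (EuclideanSpace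 ℝ (Fin 3) →L[ℝ] EuclideanSpace ℝ (Fin 3))) (T : (Fin N → ℝ)→(Fin N → ℝ → EuclideanSpace ℝ (Fin 3)) → Fin N → ℝ → EuclideanSpace ℝ (Fin 3)) : Prop :=
  (∀ j, ContinuousOn (fun q:(Fin N → ℝ) × ℝ => (α q.1, γ q.1 j, X q.1 j q.2, w q.1 j q.2)) ({p:Fin N → ℝ | ∀ i, p i ∈ Icc 0 1} ×ˢ univ))∧(∀ p:Fin N → ℝ, (∀ i, p i ∈ Icc 0 1) → α p ≠ 0 ∧ (∀ j, γ p j ≠ 0)∧(∀ j, ContDiff ℝ 2 (X p j) ∧ Differentiable ℝ (w p j)∧(∀ τ, ‖deriv (X p j) τ‖ = 1)∧(∀ τ, ‖iteratedDeriv 2 (X p j) τ‖*√Γ≤K) ∧ Tendsto (fun τ => ‖X p j τ‖) (cocompact ℝ) atTop)∧(∀ j k, j ≠ k → ∀ τ σ, ρ*√Γ≤‖X p j τ-X p k σ‖)∧(∀ j τ σ, ρ*√Γ≤|τ-σ| → cg*ρ*√Γ≤‖X p j τ-X p j σ‖)∧(∀ j τ, cg*|τ-c p j|≤Rw*√Γ+‖X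 p j τ‖)∧(∀ j τ, w p j τ = ⟪v p (X p j τ), deriv (X p j) τ⟫_ℝ)∧(∀ j τ, ‖X p j τ‖≤Rb*√(Γ*Real.log Γ) → v p (X p j τ) = w p j τ • deriv (X p j) τ)∧(∀ j, ‖X p j (c p j)‖≤Rw*√Γ)∧(∀ j, |⟪deriv (X p j) (c p j), EuclideanSpace.single 2 1⟫_ℝ|≤1-θ₀)∧(θ₀≤|α p| ∧ |α p|≤θ₀⁻¹ ∧ ∀ j, θ₀≤|γ p j| ∧ |γ p j|≤θ₀⁻¹)∧(∀ j, w p j (c p j) = 0 ∧ (∀ τ, w p j τ = 0 → τ = c p j) ∧ 3/2+δ≤deriv (w p j) (c p j) ∧ deriv (w p j) (c p j)≤Λ)∧(∀ j, Orthonormal ℝ ![deriv (X p j) (c p j), m p j, n p j] ∧ ⟪A p j (m p j), m p j⟫_ℝ+⟪A p j (n p j), n p j⟫_ℝ < 0 ∧ ⟪A p j (n p j), m p j⟫_ℝ * ⟪A p j (m p j), n p j⟫_ℝ < ⟪A p j (m p j), m p j⟫_ℝ * ⟪A p j (n p j), n p j⟫_ℝ)∧(∀ Y:Fin N → ℝ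 → EuclideanSpace ℝ (Fin 3), (∀ j, ContDiff ℝ 2 (Y j))→(∀ j τ, ⟪Y j τ, deriv (X p j) τ⟫_ℝ = 0) → (∀ j τ, Rb*√(Γ*Real.log Γ) < ‖X p j τ‖ → Y j τ = 0) → ∑ j, ⟪Y j (c p j), cross (EuclideanSpace.single 2 1) (X p j (c p j))⟫_ℝ = 0 → (∀ j τ, ‖Y j τ‖+‖deriv (Y j) τ‖+‖iteratedDeriv 2 (Y j) τ‖≤(1+|τ-c p j|)^b) → ∀ L:ℝ, (∀ j τ, ‖deriv (fun s:ℝ => T p (fun k σ => X p k σ+s • Y k σ) j τ) 0‖≤L*(1+|τ-c p j|)^a) → ∀ j τ, ‖Y j τ‖≤cnd*L*(1+|τ-c p j|)^b))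

/-- (verbatim) `Conj3` of `SelectionBoxRJ`: the accretion sign law over all admissible reduced families. -/
def SignLaw (N : ℕ) (Γ ρ η Rw : ℝ) (α : (Fin N → ℝ) → ℝ) (X : (Fin N → ℝ) → Fin N → ℝ → EuclideanSpace ℝ (Fin 3)) (c : (Fin N → ℝ) → Fin N → ℝ) (u : (Fin N → ℝ)→(Fin N → ℝ → EuclideanSpace ℝ (Fin 3)) → EuclideanSpace ℝ (Fin 3) → EuclideanSpace ℝ (Fin 3)) (D : (Fin N → ℝ) → Fin N → EuclideanSpace ℝ (Fin 3) → EuclideanSpace ℝ (Fin 3)) : Prop :=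
  ∀ (C₀ M:ℝ) (U:(Fin N → ℝ) → EuclideanSpace ℝ (Fin 3) → EuclideanSpace ℝ (Fin 3)) (P:(Fin N → ℝ) → EuclideanSpace ℝ (Fin 3) → ℝ) (B:(Fin N → ℝ) → Fin N → ℝ), (ContinuousOn B {p:Fin N → ℝ | ∀ i, p i ∈ Icc 0 1} ∧ ∀ p:Fin N → ℝ, (∀ i, p i ∈ Icc 0 1) → U p ≠ 0 ∧ ContDiff ℝ (⊤:ℕ∞) (U p) ∧ ContDiff ℝ (⊤:ℕ∞) (P p) ∧ VectorCalculus.IsDivFree (U p)∧(∀ y, α p • (cross (EuclideanSpace.single 2 1) (U p y)-fderiv ℝ (U p) y (cross (EuclideanSpace.single 2 1) y))+(1/2:ℝ) • U p y+(1/2:ℝ) • fderiv ℝ (U p) y y-(Laplacian.laplacian (U p)) y+fderiv ℝ (U p) y (U p y)+gradient (P p) y = ∑ j, B p j • D p j y)∧(∀ y, ‖U p y‖≤C₀/(1+‖y‖))∧(∀ y, |P p y|≤M)∧(∀ y, ‖y‖≤Rw*√Γ → (∀ j τ, ρ*√Γ/4≤‖y-X p j τ‖) → ‖U p y-u p (X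 p) y‖≤η*√Γ))→(∀ (j:Fin N) (p q:Fin N → ℝ), (∀ i, p i ∈ Icc 0 1)→(∀ i, q i ∈ Icc 0 1) → p j = 0 → q j = 1 → B p j*B q j < 0)

/-- Sanity: the crux IS `∃ consts, pos ∧ ∀ Γ ≥ Γ₂, ∃ data, ∀ ops, defs → BoxClausesJ ∧ SignLaw` (definitional). [folklore] -/
theorem selectionBoxRJ_iff :
    SelectionBoxRJ ↔ (∃ (N:ℕ) (δ ρ K Λ a b cnd η Rw Rb cg θ₀ Γ₂:ℝ), 0 < N ∧ 0 < δ ∧ 0 < ρ ∧ 0 ≤ a ∧ 0 < cnd ∧ 0 < η ∧ 0 < Rw ∧ 0 < Rb ∧ 0 < cg ∧ 0 < θ₀ ∧ ∀ Γ:ℝ, Γ₂≤Γ → ∃ (γ:(Fin N → ℝ) → Fin N → ℝ) (α:(Fin N → ℝ) → ℝ) (X:(Fin N → ℝ) → Fin N → ℝ → EuclideanSpace ℝ (Fin 3)) (w:(Fin N → ℝ) → Fin N → ℝ → ℝ) (c:(Fin N → ℝ) → Fin N → ℝ) (m n:(Fin N → ℝ) → Fin N → EuclideanSpace ℝ (Fin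 3)), ∀ (u:(Fin N → ℝ)→(Fin N → ℝ → EuclideanSpace ℝ (Fin 3)) → EuclideanSpace ℝ (Fin 3) → EuclideanSpace ℝ (Fin 3)) (v:(Fin N → ℝ) → EuclideanSpace ℝ (Fin 3) → EuclideanSpace ℝ (Fin 3)) (A:(Fin N → ℝ) → Fin N → (EuclideanSpace ℝ (Fin 3) →L[ℝ] EuclideanSpace ℝ (Fin 3))) (T:(Fin N → ℝ)→(Fin N → ℝ → EuclideanSpace ℝ (Fin 3)) → Fin N → ℝ → EuclideanSpace ℝ (Fin 3)) (D:(Fin N → ℝ) → Fin N → EuclideanSpace ℝ (Fin 3) → EuclideanSpace ℝ (Fin 3)), (∀ p Z y, u p Z y = ∑ k, (Γ*γ p k/(4*Real.pi)) • ∫ σ:ℝ, ((‖y-Z k σ‖^2+1)^(3/2:ℝ))⁻¹ • cross (deriv (Z k) σ) (y-Z k σ))→(∀ p y, v p y = u p (X p) y+(1/2:ℝ) • y-α p • cross (EuclideanSpace.single 2 1) y)→(∀ p j, A p j = fderiv ℝ (v p) (X p j (c p j)))→(∀ p Z j τ, T p Z j τ = (u p Z (Z j τ)+(1/2:ℝ)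 • Z j τ-α p • cross (EuclideanSpace.single 2 1) (Z j τ))-(⟪u p Z (Z j τ)+(1/2:ℝ) • Z j τ-α p • cross (EuclideanSpace.single 2 1) (Z j τ), deriv (Z j) τ⟫_ℝ/‖deriv (Z j) τ‖^2) • deriv (Z j) τ)→(∀ p j y, D p j y = (Real.exp (-(⟪y-X p j (c p j), deriv (X p j) (c p j)⟫_ℝ)^2)*((1-Real.exp (-(‖y-X p j (c p j)‖^2-⟪y-X p j (c p j), deriv (X p j) (c p j)⟫_ℝ^2)))/(‖y-X p j (c p j)‖^2-⟪y-X p j (c p j), deriv (X p j) (c p j)⟫_ℝ^2))) • cross (deriv (X p j) (c p j)) (y-X p j (c p j)))→ BoxClausesJ N Γ δ ρ K Λ a b cnd Rw Rb cg θ₀ γ α X w c m n v A T ∧ SignLaw N Γ ρ η Rw α X c u D) :=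
  Iff.rfl

/-! ## 2. The window of record: the `R_π`-symmetric co-rotating skew pair -/

/-- Rotation by `π` about the `e₃` axis: `Rπ y = 2⟪y,e₃⟫ e₃ − y` (so `(y₀,y₁,y₂) ↦ (−y₀,−y₁,y₂)`). -/
def Rpi (y : EuclideanSpace ℝ (Fin 3)) : EuclideanSpace ℝ (Fin 3) :=
  (2 * ⟪y, EuclideanSpace.single 2 (1:ℝ)⟫_ℝ) • EuclideanSpace.single 2 (1:ℝ) - y

/-- Swap of the two box coordinates: `(p₀, p₁) ↦ (p₁, p₀)`. [v4] -/
def swapP (p : Fin 2 → ℝ) : Fin 2 → ℝ := fun i => p (Equiv.swap (0 : Fin 2) 1 i)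

/-- The WINDOW, v4: the `R_π`-COVARIANT co-rotating skew-pair BOX (lane ns-filament-19175-p1 g3–g7 family of record on the
diagonal; parameters from the g5 PLAN-ONLY split note): filament `1` at box parameter `(p₀, p₁)` is filament `0` at the
SWAPPED parameter `(p₁, p₀)` rotated by `π` about `e₃`, with the same parametrisation and stagnation parameter, and the
frame speed is swap-invariant — so ON THE DIAGONAL `p₀ = p₁` the pair is exactly `R_π`-symmetric (the lane's datum) while
OFF the diagonal the two filaments are detuned INDEPENDENTLY (coordinate `p_j` is free to be filament `j`'s own dial);
equal circulation weights `γ ≡ 4` (co-rotating), frame speed `α ∈ [3, 22/5]`, tilt cosine of the tangent at the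
stagnation point in `[7/10, 4/5]`, stagnation stretching `w′(c) ∈ [9/5, 13/5]`, for every `p ∈ [0,1]²`.
v1–v3 DEFECT (found by the author while freezing the F2′ prereg, 2026-08-28 04:3xZ): they imposed `X p 1 = Rπ ∘ X p 0`
for EVERY `p`, which makes `S_p1 = S_p0` identically (and, by the mirror argument on admissible families, `B ↦ B∘swap`),
so that a face sign law in BOTH coordinates is impossible by `corner_obstruction` below — the window could carry no sign
law at all.  The covariant box is the repair; nothing else in the file changed. -/
def RpiWindow (Γ : ℝ) (γ : (Fin 2 → ℝ) → Fin 2 → ℝ) (α : (Fin 2 → ℝ) → ℝ)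
    (X : (Fin 2 → ℝ) → Fin 2 → ℝ → EuclideanSpace ℝ (Fin 3)) (w : (Fin 2 → ℝ) → Fin 2 → ℝ → ℝ)
    (c : (Fin 2 → ℝ) → Fin 2 → ℝ) : Prop :=
  ∀ p : Fin 2 → ℝ, (∀ i, p i ∈ Icc 0 1) →
    (∀ j, γ p j = 4) ∧ (3 ≤ α p ∧ α p ≤ 22/5) ∧ (∀ τ, X p 1 τ = Rpi (X (swapP p) 0 τ)) ∧ (c p 1 = c (swapP p) 0) ∧
    (α (swapP p) = α p) ∧
    (∀ j, 7/10 ≤ |⟪deriv (X p j) (c p j), EuclideanSpace.single 2 (1:ℝ)⟫_ℝ| ∧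
          |⟪deriv (X p j) (c p j), EuclideanSpace.single 2 (1:ℝ)⟫_ℝ| ≤ 4/5) ∧
    (∀ j, 9/5 ≤ deriv (w p j) (c p j) ∧ deriv (w p j) (c p j) ≤ 13/5)

/-! ### 2a′. The corner obstruction (v4 diagnosis; sorry-free) -/

/-- The four corners of the box `[0,1]²`. -/
def P00 : Fin 2 → ℝ := ![0, 0]
/-- Corner `(0,1)`. -/
def P01 : Fin 2 → ℝ := ![0, 1]
/-- Corner `(1,0)`. -/
def P10 : Fin 2 → ℝ := ![1, 0]
/-- Corner `(1,1)`. -/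
def P11 : Fin 2 → ℝ := ![1, 1]

lemma P00_mem : ∀ i, P00 i ∈ Icc (0:ℝ) 1 := by intro i; fin_cases i <;> simp [P00]
lemma P01_mem : ∀ i, P01 i ∈ Icc (0:ℝ) 1 := by intro i; fin_cases i <;> simp [P01]
lemma P10_mem : ∀ i, P10 i ∈ Icc (0:ℝ) 1 := by intro i; fin_cases i <;> simp [P10]
lemma P11_mem : ∀ i, P11 i ∈ Icc (0:ℝ) 1 := by intro i; fin_cases i <;> simp [P11]

/-- **CORNER OBSTRUCTION.** No real function on the box `[0,1]²` has the face sign pattern «opposite signs across the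
faces `p₀ = 0 / 1`» AND «opposite signs across the faces `p₁ = 0 / 1`» (in the strong form of `SignLaw`: every point of
one face against every point of the opposite face): the corners `(0,0)`, `(0,1)`, `(1,1)` give three pairwise-negative
products.  Consequence (v4): on a box family that is `R_π`-LOCKED for every `p` (v1–v3's window) the slip functional has
`S_p1 = S_p0`, so `SlipPattern` in both coordinates is this impossible pattern for `f p := S p 0`; and for admissible
reduced families the mirror `U ↦ Rπ ∘ U ∘ Rπ` swaps the two amplitudes, so `SignLaw` itself forces the pattern on
`p ↦ B p 1` — i.e. a locked window carries NO sign law once one admissible family exists.  [folklore] -/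
theorem corner_obstruction (f : (Fin 2 → ℝ) → ℝ)
    (h0 : ∀ p q : Fin 2 → ℝ, (∀ i, p i ∈ Icc (0:ℝ) 1) → (∀ i, q i ∈ Icc (0:ℝ) 1) → p 0 = 0 → q 0 = 1 → f p * f q < 0)
    (h1 : ∀ p q : Fin 2 → ℝ, (∀ i, p i ∈ Icc (0:ℝ) 1) → (∀ i, q i ∈ Icc (0:ℝ) 1) → p 1 = 0 → q 1 = 1 → f p * f q < 0) :
    False := by
  have a : f P00 * f P11 < 0 := h0 P00 P11 P00_mem P11_mem (by simp [P00]) (by simp [P11])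
  have b : f P01 * f P11 < 0 := h0 P01 P11 P01_mem P11_mem (by simp [P01]) (by simp [P11])
  have c : f P00 * f P01 < 0 := h1 P00 P01 P00_mem P01_mem (by simp [P00]) (by simp [P01])
  rcases mul_neg_iff.mp a with ⟨_, _⟩ | ⟨_, _⟩ <;> rcases mul_neg_iff.mp b with ⟨_, _⟩ | ⟨_, _⟩ <;>
    rcases mul_neg_iff.mp c with ⟨_, _⟩ | ⟨_, _⟩ <;> linarith

/-- The locked-window form of the obstruction: if the two filaments' functionals coincide for every `p`
(`S p 1 = S p 0`, as `R_π`-locking forces), the two-coordinate face sign pattern of `SignLaw`/`SlipPattern` is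
contradictory. [folklore] -/
theorem no_faceSignLaw_of_locked (S : (Fin 2 → ℝ) → Fin 2 → ℝ) (hlock : ∀ p, S p 1 = S p 0)
    (h : ∀ (j : Fin 2) (p q : Fin 2 → ℝ), (∀ i, p i ∈ Icc (0:ℝ) 1) → (∀ i, q i ∈ Icc (0:ℝ) 1) →
      p j = 0 → q j = 1 → S p j * S q j < 0) : False := by
  refine corner_obstruction (fun p => S p 0) (fun p q hp hq h0 h1 => h 0 p q hp hq h0 h1) ?_
  intro p q hp hq hp1 hq1
  have := h 1 p q hp hq hp1 hq1
  simpa [hlock] using this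

/-- Statement of stub 1: a ball box (`BoxClausesJ` verbatim, `N = 2`) INSIDE the window, for all large `Γ`. -/
def BallBoxRpiWindow : Prop :=
  ∃ (δ ρ K Λ a b cnd Rw Rb cg θ₀ Γ₂:ℝ), 0 < δ ∧ 0 < ρ ∧ 0 ≤ a ∧ 0 < cnd ∧ 0 < Rw ∧ 0 < Rb ∧ 0 < cg ∧ 0 < θ₀ ∧
    ∀ Γ:ℝ, Γ₂ ≤ Γ → ∃ (γ:(Fin 2 → ℝ) → Fin 2 → ℝ) (α:(Fin 2 → ℝ) → ℝ) (X:(Fin 2 → ℝ) → Fin 2 → ℝ → EuclideanSpace ℝ (Fin 3)) (w:(Fin 2 → ℝ) → Fin 2 → ℝ → ℝ) (c:(Fin 2 → ℝ) → Fin 2 → ℝ) (m n:(Fin 2 → ℝ) → Fin 2 → EuclideanSpace ℝ (Fin 3)),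
      RpiWindow Γ γ α X w c ∧
      ∀ (u:(Fin 2 → ℝ)→(Fin 2 → ℝ → EuclideanSpace ℝ (Fin 3)) → EuclideanSpace ℝ (Fin 3) → EuclideanSpace ℝ (Fin 3)) (v:(Fin 2 → ℝ) → EuclideanSpace ℝ (Fin 3) → EuclideanSpace ℝ (Fin 3)) (A:(Fin 2 → ℝ) → Fin 2 → (EuclideanSpace ℝ (Fin 3) →L[ℝ] EuclideanSpace ℝ (Fin 3))) (T:(Fin 2 → ℝ)→(Fin 2 → ℝ → EuclideanSpace ℝ (Fin 3)) → Fin 2 → ℝ → EuclideanSpace ℝ (Fin 3)) (D:(Fin 2 → ℝ) → Fin 2 → EuclideanSpace ℝ (Fin 3) → EuclideanSpace ℝ (Fin 3)),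
        DefsH 2 Γ γ α X c u v A T D → BoxClausesJ 2 Γ δ ρ K Λ a b cnd Rw Rb cg θ₀ γ α X w c m n v A T

/-- Statement of stub 2: on the window, box ⇒ sign law, for SOME closeness tolerance `η` and threshold `Γ₁`
chosen after the Γ-free constants. -/
def SignLawRpiWindow : Prop :=
  ∀ (δ ρ K Λ a b cnd Rw Rb cg θ₀:ℝ), 0 < δ → 0 < ρ → 0 ≤ a → 0 < cnd → 0 < Rw → 0 < Rb → 0 < cg → 0 < θ₀ →
    ∃ (η Γ₁:ℝ), 0 < η ∧ ∀ Γ:ℝ, Γ₁ ≤ Γ → ∀ (γ:(Fin 2 → ℝ) → Fin 2 → ℝ) (α:(Fin 2 → ℝ) → ℝ) (X:(Fin 2 → ℝ) → Fin 2 → ℝ → EuclideanSpace ℝ (Fin 3)) (w:(Fin 2 → ℝ) → Fin 2 → ℝ → ℝ) (c:(Fin 2 → ℝ) → Fin 2 → ℝ) (m n:(Fin 2 → ℝ) → Fin 2 → EuclideanSpace ℝ (Fin 3)),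
      RpiWindow Γ γ α X w c →
      ∀ (u:(Fin 2 → ℝ)→(Fin 2 → ℝ → EuclideanSpace ℝ (Fin 3)) → EuclideanSpace ℝ (Fin 3) → EuclideanSpace ℝ (Fin 3)) (v:(Fin 2 → ℝ) → EuclideanSpace ℝ (Fin 3) → EuclideanSpace ℝ (Fin 3)) (A:(Fin 2 → ℝ) → Fin 2 → (EuclideanSpace ℝ (Fin 3) →L[ℝ] EuclideanSpace ℝ (Fin 3))) (T:(Fin 2 → ℝ)→(Fin 2 → ℝ → EuclideanSpace ℝ (Fin 3)) → Fin 2 → ℝ → EuclideanSpace ℝ (Fin 3)) (D:(Fin 2 → ℝ) → Fin 2 → EuclideanSpace ℝ (Fin 3) → EuclideanSpace ℝ (Fin 3)),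
        DefsH 2 Γ γ α X c u v A T D → BoxClausesJ 2 Γ δ ρ K Λ a b cnd Rw Rb cg θ₀ γ α X w c m n v A T →
          SignLaw 2 Γ ρ η Rw α X c u D


/-! ## 2b. The typed MECHANISM between Box and SignLaw on the window (v2, critic idea-crit-8 price P1″):
the SLIP–ACCRETION FUNCTIONAL of the skeleton and the linear-response reading of `B_pj` -/

/-- The left-hand side of the reduced profile equation of `SignLaw` (its PDE clause VERBATIM, without pressure and forcing):
`α (e₃ × V − DV (e₃ × y)) + ½ V + ½ DV·y − ΔV + DV·V`. -/
def profileOp (αp : ℝ) (V : EuclideanSpace ℝ (Fin 3) → EuclideanSpace ℝ (Fin 3)) (y : EuclideanSpace ℝ (Fin 3)) : EuclideanSpace ℝ (Fin 3) :=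
  αp • (cross (EuclideanSpace.single 2 1) (V y)-fderiv ℝ V y (cross (EuclideanSpace.single 2 1) y))+(1/2:ℝ) • V y+(1/2:ℝ) • fderiv ℝ V y y-(Laplacian.laplacian V) y+fderiv ℝ V y (V y)

/-- The Gaussian-WEIGHTED accretion mode of filament `j` at its stagnation point (the weight makes every pairing below
absolutely convergent; the bare mode `D p j` decays only like `1/r` across the section). -/
def Dw (X : (Fin 2 → ℝ) → Fin 2 → ℝ → EuclideanSpace ℝ (Fin 3)) (c : (Fin 2 → ℝ) → Fin 2 → ℝ) (D : (Fin 2 → ℝ) → Fin 2 → EuclideanSpace ℝ (Fin 3) → EuclideanSpace ℝ (Fin 3))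
    (p : Fin 2 → ℝ) (j : Fin 2) (y : EuclideanSpace ℝ (Fin 3)) : EuclideanSpace ℝ (Fin 3) :=
  Real.exp (-‖y-X p j (c p j)‖^2) • D p j y

/-- **THE SLIP–ACCRETION FUNCTIONAL** `S_pj` of the SKELETON ALONE (no PDE unknown): the linear-response prediction for the
accretion amplitude `B_pj` obtained by testing the profile equation, evaluated at the skeleton's own Biot–Savart field
`u p (X p)`, against the weighted mode: `S_pj = ⟪profileOp(u_X), D̃_pj⟫_{L²} / ⟪D_pj, D̃_pj⟫_{L²}`.  Explicit, Γ-dependent,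
computable by quadrature on any skeleton of the window (instrument N7).  Well-defined: `u_X` is the Rosenhead-REGULARISED
Biot–Savart field of `DefsH` (kernel `((‖y−Z‖²+1)^{3/2})⁻¹`, core size 1), smooth with polynomially bounded derivatives along
admissible skeletons, and `D̃` carries a full Gaussian factor, so numerator and denominator are absolutely convergent and the
denominator is `∫ e^{−‖y−X‖²}‖D_pj‖² > 0` — no Bochner junk value (typing checklist 4c(ii) checked). -/
def slip (α : (Fin 2 → ℝ) → ℝ) (X : (Fin 2 → ℝ) → Fin 2 → ℝ → EuclideanSpace ℝ (Fin 3)) (c : (Fin 2 → ℝ) → Fin 2 → ℝ)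
    (u : (Fin 2 → ℝ)→(Fin 2 → ℝ → EuclideanSpace ℝ (Fin 3)) → EuclideanSpace ℝ (Fin 3) → EuclideanSpace ℝ (Fin 3)) (D : (Fin 2 → ℝ) → Fin 2 → EuclideanSpace ℝ (Fin 3) → EuclideanSpace ℝ (Fin 3))
    (p : Fin 2 → ℝ) (j : Fin 2) : ℝ :=
  (∫ y, ⟪profileOp (α p) (u p (X p)) y, Dw X c D p j y⟫_ℝ) / (∫ y, ⟪D p j y, Dw X c D p j y⟫_ℝ)

/-- **v5 (Burgers–Leray proxy core).** Equilibrium core width of filament `j` at its stagnation point in Leray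
variables: the skeleton's axial stretching there is `ε_u = w′(c) − 1/2` (the `½` is the scaling term's own contribution to
`w′`), and the `m = 0` balance `−ΔΩ + (1 − ε_u)(Ω + ½ρ∂_ρΩ) = 0` of a straight stretched tube is solved by the Gaussian
`Ω ∝ exp(−(ε_u − 1)ρ²/4)` iff `ε_u > 1`, i.e. iff `w′(c) > 3/2` — supercritical stretching, which the window `w′(c) ∈ [9/5, 13/5]`
guarantees; its width is `a = 2/√(w′(c) − 3/2) ∈ [1.9, 3.7]` core units. [folklore: Burgers vortex in self-similar variables] -/
def aBL (w : (Fin 2 → ℝ) → Fin 2 → ℝ → ℝ) (c : (Fin 2 → ℝ) → Fin 2 → ℝ) (p : Fin 2 → ℝ) (j : Fin 2) : ℝ :=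
  2 / Real.sqrt (deriv (w p j) (c p j) - 3/2)

/-- **Supercriticality is a clause of the window, not prose** (critic idea-crit-7, 06:35:55Z (2)): on `RpiWindow` boxes the
stagnation stretching satisfies `w′(c) − 3/2 ∈ [3/10, 11/10]`, i.e. `ε_u = w′(c) − ½ ∈ [13/10, 21/10] > 1`, so the Burgers–Leray width
`aBL = 2/√(w′(c) − 3/2)` is positive and finite (between `2/√(11/10) ≈ 1.91` and `2/√(3/10) ≈ 3.65`) — it never degenerates on the window. [folklore] -/
theorem aBL_window_supercritical (Γ : ℝ) (γ : (Fin 2 → ℝ) → Fin 2 → ℝ) (α : (Fin 2 → ℝ) → ℝ)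
    (X : (Fin 2 → ℝ) → Fin 2 → ℝ → EuclideanSpace ℝ (Fin 3)) (w : (Fin 2 → ℝ) → Fin 2 → ℝ → ℝ)
    (c : (Fin 2 → ℝ) → Fin 2 → ℝ) (hwin : RpiWindow Γ γ α X w c) (p : Fin 2 → ℝ) (hp : ∀ i, p i ∈ Icc 0 1)
    (j : Fin 2) :
    3/10 ≤ deriv (w p j) (c p j) - 3/2 ∧ deriv (w p j) (c p j) - 3/2 ≤ 11/10 ∧ 0 < aBL w c p j ∧
      aBL w c p j ≤ 2 / Real.sqrt (3/10) ∧ 2 / Real.sqrt (11/10) ≤ aBL w c p j := by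
  obtain ⟨-, -, -, -, -, -, hw⟩ := hwin p hp
  obtain ⟨h1, h2⟩ := hw j
  have hpos : 0 < deriv (w p j) (c p j) - 3/2 := by linarith
  have hs : 0 < Real.sqrt (deriv (w p j) (c p j) - 3/2) := Real.sqrt_pos.mpr hpos
  have hs3 : 0 < Real.sqrt (3/10) := Real.sqrt_pos.mpr (by norm_num)
  have hs11 : 0 < Real.sqrt (11/10) := Real.sqrt_pos.mpr (by norm_num)
  refine ⟨by linarith, by linarith, ?_, ?_, ?_⟩
  · unfold aBL; exact div_pos two_pos hs
  · unfold aBL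
    apply div_le_div_of_nonneg_left (by norm_num) hs3
    exact Real.sqrt_le_sqrt (by linarith)
  · unfold aBL
    apply div_le_div_of_nonneg_left (by norm_num) hs
    exact Real.sqrt_le_sqrt (by linarith)

/-- **v5 proxy field `u^BL_X`: the skeleton's Biot–Savart field with each filament `k` smoothed by the 3-D Gaussian of ITS
Burgers–Leray width `a_k`** (Gaussian convolution of the singular Biot–Savart law; for a straight filament the cross-section
vorticity is the 2-D Gaussian `(π a²)⁻¹ e^{−ρ²/a²}`, the Leray-equilibrium core when `a = aBL`).  Same circulations
`Γγ_k` as `DefsH`'s Rosenhead field and the same far field (both tend to the singular law off the cores), so the window's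
off-tube closeness clause is insensitive to the swap; only the CORE seen by the weighted mode changes.  WHY (v5 diagnosis,
pre-data hand model 2026-08-28 06:31Z): with the Rosenhead unit core the `m = 0` projection of `profileOp(u_X)` at `X(c)` is
dominated by the `p`-INDEPENDENT core mismatch `⟪−Δu + ½(u + y·∇u), D̃⟫/⟪D, D̃⟫ ≈ (1.637 + 0.342·(3/2 − w′(c)))·Γ > 0` on the
whole window, so its SIGN carries no skeleton geometry; with the equilibrium core that universal part vanishes by
construction and the functional reads the geometric next order.  (Inner integral: singular Biot–Savart law of filament `k`,
finite off the curve, junk only ON the curve — a null set for the outer Gaussian integral.) -/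
def uBL (Γ : ℝ) (γ : (Fin 2 → ℝ) → Fin 2 → ℝ) (w : (Fin 2 → ℝ) → Fin 2 → ℝ → ℝ) (c : (Fin 2 → ℝ) → Fin 2 → ℝ)
    (p : Fin 2 → ℝ) (Z : Fin 2 → ℝ → EuclideanSpace ℝ (Fin 3)) (y : EuclideanSpace ℝ (Fin 3)) : EuclideanSpace ℝ (Fin 3) :=
  ∑ k : Fin 2, (Γ * γ p k / (4 * Real.pi)) •
    ∫ x : EuclideanSpace ℝ (Fin 3), (Real.exp (-‖y - x‖^2 / (aBL w c p k)^2) / (Real.pi ^ (3/2:ℝ) * (aBL w c p k)^3)) •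
      ∫ σ : ℝ, (‖x - Z k σ‖^3)⁻¹ • cross (deriv (Z k) σ) (x - Z k σ)

/-- (verbatim) the ADMISSIBLE REDUCED FAMILY hypothesis of `SignLaw` (its antecedent, `N = 2`): `B` continuous on the cube;
for each `p`: `U p ≠ 0` smooth, `P p` smooth, `U p` divergence-free, the forced profile equation with amplitudes `B p j` on the
modes `D p j`, decay `C₀/(1+‖y‖)`, `|P| ≤ M`, and windowed closeness `‖U − u_X‖ ≤ η√Γ` on `‖y‖ ≤ Rw√Γ` off the `ρ√Γ/4`-tubes. -/
def AdmissibleJ (Γ ρ η Rw : ℝ) (α : (Fin 2 → ℝ) → ℝ) (X : (Fin 2 → ℝ) → Fin 2 → ℝ → EuclideanSpace ℝ (Fin 3)) (c : (Fin 2 → ℝ) → Fin 2 → ℝ)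
    (u : (Fin 2 → ℝ)→(Fin 2 → ℝ → EuclideanSpace ℝ (Fin 3)) → EuclideanSpace ℝ (Fin 3) → EuclideanSpace ℝ (Fin 3)) (D : (Fin 2 → ℝ) → Fin 2 → EuclideanSpace ℝ (Fin 3) → EuclideanSpace ℝ (Fin 3))
    (C₀ M : ℝ) (U : (Fin 2 → ℝ) → EuclideanSpace ℝ (Fin 3) → EuclideanSpace ℝ (Fin 3)) (P : (Fin 2 → ℝ) → EuclideanSpace ℝ (Fin 3) → ℝ) (B : (Fin 2 → ℝ) → Fin 2 → ℝ) : Prop :=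
  (ContinuousOn B {p:Fin 2 → ℝ | ∀ i, p i ∈ Icc 0 1} ∧ ∀ p:Fin 2 → ℝ, (∀ i, p i ∈ Icc 0 1) → U p ≠ 0 ∧ ContDiff ℝ (⊤:ℕ∞) (U p) ∧ ContDiff ℝ (⊤:ℕ∞) (P p) ∧ VectorCalculus.IsDivFree (U p)∧(∀ y, α p • (cross (EuclideanSpace.single 2 1) (U p y)-fderiv ℝ (U p) y (cross (EuclideanSpace.single 2 1) y))+(1/2:ℝ) • U p y+(1/2:ℝ) • fderiv ℝ (U p) y y-(Laplacian.laplacian (U p)) y+fderiv ℝ (U p) y (U p y)+gradient (P p) y = ∑ j, B p j • D p j y)∧(∀ y, ‖U p y‖≤C₀/(1+‖y‖))∧(∀ y, |P p y|≤M)∧(∀ y, ‖y‖≤Rw*√Γ → (∀ j τ, ρ*√Γ/4≤‖y-X p j τ‖) → ‖U p y-u p (X p) y‖≤η*√Γ))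

/-- Sanity (definitional): on two filaments, `SignLaw` is «every admissible reduced family has `B_pj·B_qj < 0` across face `j`». -/
theorem signLaw_two_iff (Γ ρ η Rw : ℝ) (α : (Fin 2 → ℝ) → ℝ) (X : (Fin 2 → ℝ) → Fin 2 → ℝ → EuclideanSpace ℝ (Fin 3)) (c : (Fin 2 → ℝ) → Fin 2 → ℝ)
    (u : (Fin 2 → ℝ)→(Fin 2 → ℝ → EuclideanSpace ℝ (Fin 3)) → EuclideanSpace ℝ (Fin 3) → EuclideanSpace ℝ (Fin 3)) (D : (Fin 2 → ℝ) → Fin 2 → EuclideanSpace ℝ (Fin 3) → EuclideanSpace ℝ (Fin 3)) :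
    SignLaw 2 Γ ρ η Rw α X c u D ↔
      ∀ (C₀ M:ℝ) (U:(Fin 2 → ℝ) → EuclideanSpace ℝ (Fin 3) → EuclideanSpace ℝ (Fin 3)) (P:(Fin 2 → ℝ) → EuclideanSpace ℝ (Fin 3) → ℝ) (B:(Fin 2 → ℝ) → Fin 2 → ℝ),
        AdmissibleJ Γ ρ η Rw α X c u D C₀ M U P B →
          (∀ (j:Fin 2) (p q:Fin 2 → ℝ), (∀ i, p i ∈ Icc 0 1)→(∀ i, q i ∈ Icc 0 1) → p j = 0 → q j = 1 → B p j*B q j < 0) :=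
  Iff.rfl

/-- **The slip sign pattern across face `j` with a RELATIVE floor `s₀`** (scale-free; no supremum, pointwise domination):
opposite signs of `S_pj`, `S_qj` on the two faces, each dominating `s₀·|S_rj|` for every `r` in the cube. -/
def SlipPattern (s₀ : ℝ) (S : (Fin 2 → ℝ) → Fin 2 → ℝ) (j : Fin 2) (p q : Fin 2 → ℝ) : Prop :=
  S p j * S q j < 0 ∧ ∀ r : Fin 2 → ℝ, (∀ i, r i ∈ Icc 0 1) → s₀ * |S r j| ≤ |S p j| ∧ s₀ * |S r j| ≤ |S q j|

/-- `swapP` exchanges the coordinates. -/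
@[simp] lemma swapP_zero (p : Fin 2 → ℝ) : swapP p 0 = p 1 := by simp [swapP, Equiv.swap_apply_left]
@[simp] lemma swapP_one (p : Fin 2 → ℝ) : swapP p 1 = p 0 := by simp [swapP, Equiv.swap_apply_right]
lemma swapP_mem {p : Fin 2 → ℝ} (hp : ∀ i, p i ∈ Icc (0:ℝ) 1) : ∀ i, swapP p i ∈ Icc (0:ℝ) 1 :=
  fun i => hp _

/-- **COVARIANCE HALVES THE SIGN PATTERN (v4.1, critic idea-crit-7 P5).** On the covariant box the slip functional is
`R_π`-covariant: `S p 1 = S (swap p) 0` — because `DefsH`'s `u p (X p)` is the regularised Biot–Savart field of the pair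
`{X p 0, Rπ ∘ X (swap p) 0}`, whose image under `Rπ` is the pair at the swapped parameter with the labels exchanged, while
`profileOp` commutes with `Rπ` (a rotation about `e₃`) and `Rπ_* D_{p,1} = D_{swap p,0}`, `Rπ_* D̃_{p,1} = D̃_{swap p,0}` (the
analytic identity itself is NOT proved here; it is the hypothesis `hcov`).  GIVEN that identity, the face pattern of
`SlipPattern` in coordinate `1` across `p₁ = 0/1` IS the pattern in coordinate `0` across `p₀ = 0/1` — so stub 2a needs, and
the F2′ sweep computes, only filament `0`'s functional along its own dial. [folklore] -/
theorem slipPattern_one_of_covariant (s₀ : ℝ) (S : (Fin 2 → ℝ) → Fin 2 → ℝ) (hcov : ∀ p, S p 1 = S (swapP p) 0)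
    (h0 : ∀ p q : Fin 2 → ℝ, (∀ i, p i ∈ Icc (0:ℝ) 1) → (∀ i, q i ∈ Icc (0:ℝ) 1) → p 0 = 0 → q 0 = 1 →
      SlipPattern s₀ S 0 p q) :
    ∀ p q : Fin 2 → ℝ, (∀ i, p i ∈ Icc (0:ℝ) 1) → (∀ i, q i ∈ Icc (0:ℝ) 1) → p 1 = 0 → q 1 = 1 →
      SlipPattern s₀ S 1 p q := by
  intro p q hp hq hp1 hq1
  have h := h0 (swapP p) (swapP q) (swapP_mem hp) (swapP_mem hq) (by simpa using hp1) (by simpa using hq1)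
  rcases h with ⟨hsign, hdom⟩
  refine ⟨by simpa [hcov] using hsign, fun r hr => ?_⟩
  have := hdom (swapP r) (swapP_mem hr)
  simpa [hcov] using this

/-- Statement of stub 2a (M1, SKELETON-ONLY, computable): on window boxes obeying `BoxClausesJ`, for all large `Γ`, the
slip–accretion functional has OPPOSITE SIGNS on the faces `p_j = 0` / `p_j = 1` with a Γ-free relative floor `s₀ > 0`. -/
def SlipSignRpiWindow : Prop :=
  ∀ (δ ρ K Λ a b cnd Rw Rb cg θ₀:ℝ), 0 < δ → 0 < ρ → 0 ≤ a → 0 < cnd → 0 < Rw → 0 < Rb → 0 < cg → 0 < θ₀ →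
    ∃ (s₀ Γ₁:ℝ), 0 < s₀ ∧ ∀ Γ:ℝ, Γ₁ ≤ Γ → ∀ (γ:(Fin 2 → ℝ) → Fin 2 → ℝ) (α:(Fin 2 → ℝ) → ℝ) (X:(Fin 2 → ℝ) → Fin 2 → ℝ → EuclideanSpace ℝ (Fin 3)) (w:(Fin 2 → ℝ) → Fin 2 → ℝ → ℝ) (c:(Fin 2 → ℝ) → Fin 2 → ℝ) (m n:(Fin 2 → ℝ) → Fin 2 → EuclideanSpace ℝ (Fin 3)),
      RpiWindow Γ γ α X w c →
      ∀ (u:(Fin 2 → ℝ)→(Fin 2 → ℝ → EuclideanSpace ℝ (Fin 3)) → EuclideanSpace ℝ (Fin 3) → EuclideanSpace ℝ (Fin 3)) (v:(Fin 2 → ℝ) → EuclideanSpace ℝ (Fin 3) → EuclideanSpace ℝ (Fin 3)) (A:(Fin 2 → ℝ) → Fin 2 → (EuclideanSpace ℝ (Fin 3) →L[ℝ] EuclideanSpace ℝ (Fin 3))) (T:(Fin 2 → ℝ)→(Fin 2 → ℝ → EuclideanSpace ℝ (Fin 3)) → Fin 2 → ℝ → EuclideanSpace ℝ (Fin 3))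 (D:(Fin 2 → ℝ) → Fin 2 → EuclideanSpace ℝ (Fin 3) → EuclideanSpace ℝ (Fin 3)),
        DefsH 2 Γ γ α X c u v A T D → BoxClausesJ 2 Γ δ ρ K Λ a b cnd Rw Rb cg θ₀ γ α X w c m n v A T →
          ∀ (j:Fin 2) (p q:Fin 2 → ℝ), (∀ i, p i ∈ Icc 0 1)→(∀ i, q i ∈ Icc 0 1) → p j = 0 → q j = 1 →
            SlipPattern s₀ (slip α X c u D) j p q

/-- Statement of stub 2b (M2 as a SIGN-RESPONSE / core-universality claim — the analytic stub): given any relative slip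
floor `s₀ > 0` there are a closeness tolerance `η > 0` and `Γ₁` such that on window boxes with the slip pattern, EVERY
admissible reduced family has accretion amplitudes of the SAME SIGN as the skeleton's slip functional on the faces:
`0 < B_pj · S_pj`.  (Only the sign is asserted — exactly what the composition uses; v2's `|B_pj − S_pj| < |S_pj|` was stronger
than needed.)  NOTE WHERE THE WEIGHT SITS: `D̃_pj` is a unit-scale Gaussian at the stagnation point, i.e. INSIDE the
`ρ√Γ/4`-tube of filament `j`, where `AdmissibleJ` imposes NO closeness (closeness `η√Γ` holds only off the tubes); and `u_X` is
the ROSENHEAD-REGULARISED skeleton field of `DefsH` (kernel `((‖y−Z‖²+1)^{3/2})⁻¹`, core size 1 — smooth, so `slip` is a finite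
integral, no junk value), a proxy core, not the true viscous core.  So this stub is NOT a perturbative estimate: it is the claim
that the SIGN of the accretion amplitude is decided by the OUTER slip/strain of the configuration at the stagnation section
and is independent of the core profile (core universality of the first azimuthal harmonic's sign), the outer field being pinned
by the off-tube closeness. -/
def SignResponseRpiWindow : Prop :=
  ∀ (δ ρ K Λ a b cnd Rw Rb cg θ₀:ℝ), 0 < δ → 0 < ρ → 0 ≤ a → 0 < cnd → 0 < Rw → 0 < Rb → 0 < cg → 0 < θ₀ →
    ∀ s₀:ℝ, 0 < s₀ → ∃ (η Γ₁:ℝ), 0 < η ∧ ∀ Γ:ℝ, Γ₁ ≤ Γ → ∀ (γ:(Fin 2 → ℝ) → Fin 2 → ℝ) (α:(Fin 2 → ℝ) → ℝ) (X:(Fin 2 → ℝ) → Fin 2 → ℝ → EuclideanSpace ℝ (Fin 3)) (w:(Fin 2 → ℝ) → Fin 2 → ℝ → ℝ) (c:(Fin 2 → ℝ) → Fin 2 → ℝ) (m n:(Fin 2 → ℝ) → Fin 2 → EuclideanSpace ℝ (Fin 3)),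
      RpiWindow Γ γ α X w c →
      ∀ (u:(Fin 2 → ℝ)→(Fin 2 → ℝ → EuclideanSpace ℝ (Fin 3)) → EuclideanSpace ℝ (Fin 3) → EuclideanSpace ℝ (Fin 3)) (v:(Fin 2 → ℝ) → EuclideanSpace ℝ (Fin 3) → EuclideanSpace ℝ (Fin 3)) (A:(Fin 2 → ℝ) → Fin 2 → (EuclideanSpace ℝ (Fin 3) →L[ℝ] EuclideanSpace ℝ (Fin 3))) (T:(Fin 2 → ℝ)→(Fin 2 → ℝ → EuclideanSpace ℝ (Fin 3)) → Fin 2 → ℝ → EuclideanSpace ℝ (Fin 3)) (D:(Fin 2 → ℝ) → Fin 2 → EuclideanSpace ℝ (Fin 3) → EuclideanSpace ℝ (Fin 3)),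
        DefsH 2 Γ γ α X c u v A T D → BoxClausesJ 2 Γ δ ρ K Λ a b cnd Rw Rb cg θ₀ γ α X w c m n v A T →
          ∀ (C₀ M:ℝ) (U:(Fin 2 → ℝ) → EuclideanSpace ℝ (Fin 3) → EuclideanSpace ℝ (Fin 3)) (P:(Fin 2 → ℝ) → EuclideanSpace ℝ (Fin 3) → ℝ) (B:(Fin 2 → ℝ) → Fin 2 → ℝ),
            AdmissibleJ Γ ρ η Rw α X c u D C₀ M U P B →
            ∀ (j:Fin 2) (p q:Fin 2 → ℝ), (∀ i, p i ∈ Icc 0 1)→(∀ i, q i ∈ Icc 0 1) → p j = 0 → q j = 1 →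
              SlipPattern s₀ (slip α X c u D) j p q →
                0 < B p j * slip α X c u D p j ∧ 0 < B q j * slip α X c u D q j

/-- **v5 stub 2a statement**: `SlipSignRpiWindow` with the slip functional evaluated on the Burgers–Leray proxy field `uBL`
(everything else verbatim; `DefsH`'s `u` stays quantified and unused by the conclusion). -/
def SlipSignBLWindow : Prop :=
  ∀ (δ ρ K Λ a b cnd Rw Rb cg θ₀:ℝ), 0 < δ → 0 < ρ → 0 ≤ a → 0 < cnd → 0 < Rw → 0 < Rb → 0 < cg → 0 < θ₀ →
    ∃ (s₀ Γ₁:ℝ), 0 < s₀ ∧ ∀ Γ:ℝ, Γ₁ ≤ Γ → ∀ (γ:(Fin 2 → ℝ) → Fin 2 → ℝ) (α:(Fin 2 → ℝ) → ℝ) (X:(Fin 2 → ℝ) → Fin 2 → ℝ → EuclideanSpace ℝ (Fin 3)) (w:(Fin 2 → ℝ) → Fin 2 → ℝ → ℝ) (c:(Fin 2 → ℝ) → Fin 2 → ℝ) (m n:(Fin 2 → ℝ) → Fin 2 → EuclideanSpace ℝ (Fin 3)),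
      RpiWindow Γ γ α X w c →
      ∀ (u:(Fin 2 → ℝ)→(Fin 2 → ℝ → EuclideanSpace ℝ (Fin 3)) → EuclideanSpace ℝ (Fin 3) → EuclideanSpace ℝ (Fin 3)) (v:(Fin 2 → ℝ) → EuclideanSpace ℝ (Fin 3) → EuclideanSpace ℝ (Fin 3)) (A:(Fin 2 → ℝ) → Fin 2 → (EuclideanSpace ℝ (Fin 3) →L[ℝ] EuclideanSpace ℝ (Fin 3))) (T:(Fin 2 → ℝ)→(Fin 2 → ℝ → EuclideanSpace ℝ (Fin 3)) → Fin 2 → ℝ → EuclideanSpace ℝ (Fin 3)) (D:(Fin 2 → ℝ) → Fin 2 → EuclideanSpace ℝ (Fin 3) → EuclideanSpace ℝ (Fin 3)),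
        DefsH 2 Γ γ α X c u v A T D → BoxClausesJ 2 Γ δ ρ K Λ a b cnd Rw Rb cg θ₀ γ α X w c m n v A T →
          ∀ (j:Fin 2) (p q:Fin 2 → ℝ), (∀ i, p i ∈ Icc 0 1)→(∀ i, q i ∈ Icc 0 1) → p j = 0 → q j = 1 →
            SlipPattern s₀ (slip α X c (uBL Γ γ w c) D) j p q

/-- **v5 stub 2b statement**: `SignResponseRpiWindow` with `S := slip … (uBL Γ γ w c) …` (sign agreement of the admissible
accretion amplitudes with the Burgers–Leray-core functional on the faces; everything else verbatim). -/
def SignResponseBLWindow : Prop :=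
  ∀ (δ ρ K Λ a b cnd Rw Rb cg θ₀:ℝ), 0 < δ → 0 < ρ → 0 ≤ a → 0 < cnd → 0 < Rw → 0 < Rb → 0 < cg → 0 < θ₀ →
    ∀ s₀:ℝ, 0 < s₀ → ∃ (η Γ₁:ℝ), 0 < η ∧ ∀ Γ:ℝ, Γ₁ ≤ Γ → ∀ (γ:(Fin 2 → ℝ) → Fin 2 → ℝ) (α:(Fin 2 → ℝ) → ℝ) (X:(Fin 2 → ℝ) → Fin 2 → ℝ → EuclideanSpace ℝ (Fin 3)) (w:(Fin 2 → ℝ) → Fin 2 → ℝ → ℝ) (c:(Fin 2 → ℝ) → Fin 2 → ℝ) (m n:(Fin 2 → ℝ) → Fin 2 → EuclideanSpace ℝ (Fin 3)),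
      RpiWindow Γ γ α X w c →
      ∀ (u:(Fin 2 → ℝ)→(Fin 2 → ℝ → EuclideanSpace ℝ (Fin 3)) → EuclideanSpace ℝ (Fin 3) → EuclideanSpace ℝ (Fin 3)) (v:(Fin 2 → ℝ) → EuclideanSpace ℝ (Fin 3) → EuclideanSpace ℝ (Fin 3)) (A:(Fin 2 → ℝ) → Fin 2 → (EuclideanSpace ℝ (Fin 3) →L[ℝ] EuclideanSpace ℝ (Fin 3))) (T:(Fin 2 → ℝ)→(Fin 2 → ℝ → EuclideanSpace ℝ (Fin 3)) → Fin 2 → ℝ → EuclideanSpace ℝ (Fin 3)) (D:(Fin 2 → ℝ) → Fin 2 → EuclideanSpace ℝ (Fin 3) → EuclideanSpace ℝ (Fin 3)),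
        DefsH 2 Γ γ α X c u v A T D → BoxClausesJ 2 Γ δ ρ K Λ a b cnd Rw Rb cg θ₀ γ α X w c m n v A T →
          ∀ (C₀ M:ℝ) (U:(Fin 2 → ℝ) → EuclideanSpace ℝ (Fin 3) → EuclideanSpace ℝ (Fin 3)) (P:(Fin 2 → ℝ) → EuclideanSpace ℝ (Fin 3) → ℝ) (B:(Fin 2 → ℝ) → Fin 2 → ℝ),
            AdmissibleJ Γ ρ η Rw α X c u D C₀ M U P B →
            ∀ (j:Fin 2) (p q:Fin 2 → ℝ), (∀ i, p i ∈ Icc 0 1)→(∀ i, q i ∈ Icc 0 1) → p j = 0 → q j = 1 →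
              SlipPattern s₀ (slip α X c (uBL Γ γ w c) D) j p q →
                0 < B p j * slip α X c (uBL Γ γ w c) D p j ∧ 0 < B q j * slip α X c (uBL Γ γ w c) D q j

/-! ## 3. Registered stubs and the kernel-checked composition (v2: three stubs — box · slip sign · linear response) -/

/-- **Stub 1 (`stub_ballBox_rpiWindow`, size XL; filament analysis + certified numerics — the lane's trajectory).**
Γ-free constants `(δ, ρ, K, Λ, a ≥ 0, b, cnd, Rw, Rb, cg, θ₀)` and `Γ₂` such that for every `Γ ≥ Γ₂` there is a
2-parameter `C⁰` box `p ∈ [0,1]²` of `R_π`-symmetric co-rotating skew pairs in the window (`γ ≡ 4`, `α ∈ [3, 22/5]`,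
tilt cos ∈ [7/10, 4/5], `w′(c) ∈ [9/5, 13/5]`) satisfying the ball-box clauses of the crux VERBATIM.  Why plausibly true:
the window is numerically INHABITED except for clause 13 (kit j283832 / j284150; lane g4 PATH A: α 3.0–4.4, tilt 33–48°,
separation 0.30–0.44, unique supercritical zero V′(c) ≈ 2.3–2.4, hyperbolic), and the lane's rungs close in on exact
ball tangency Γ-uniformly: R2 `SelectionBoxRJRung.truePartnerArc_exists` (the cut-off local-induction arc with the TRUE
`R_π`-partner Biot–Savart interaction exists ∀ Γ ≥ exp(Rb⁻²)), R3⁻ `trueKernel_defect_rung` (full true skeleton velocity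
tangent on the ball up to √Γ/60), zone lemma `box_zone_zero_unique_quantitative` (clause 11 can only fail in the
Γ-independent strain zone).  Why it might fail: exact tangency on the ball of radius `Rb√(Γ log Γ)` with a Γ-UNIFORM `Rb`
may force `Rb` above the second-zero cap (ξ* = 0.93 ± 0.03 ⇒ Rb < 0.37 on the launch family) — then clause 11 (unique zero)
and clause 12 (waist) cannot both hold in the window; clause 13 (ball-supported weighted injectivity) is unverified on any datum; SIZE XL (not L–XL) since lane g8's
R3-OBSTRUCTION memo (evidence on 21220, 2026-08-28 02:52Z): exact true-kernel tangency is NOT a `(T,T′)` contraction — the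
Rosenhead symbol has a zero at `k* = 1.114` (stationary Kelvin ripple ⇒ near-kernel; «IFT with ripple selection»), and F1's
`Rb` cap is live.
Leans on: the 44 landed `Theorems/FilamentSkeletonRssSelectionBoxRJRung*.lean` files (p568152 … p595099), GutierrezVega2004,
Banica–Vega arXiv:0802.1996, doi:10.1017/jfm.2012.270. -/
theorem stub_ballBox_rpiWindow : BallBoxRpiWindow := by
  sorry

/-- **Stub 2a (v5: `stub_slipSignBL_rpiWindow` on the Burgers–Leray proxy core; v4.1's `stub_slipSign_rpiWindow` on the Rosenhead core is SUPERSEDED — predicted dead by the 06:31Z hand model, verdict by PREREG Stage 1; size L; SKELETON-ONLY — filament asymptotics + certified quadrature, instrument N7).**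
On window boxes the explicit slip–accretion functional `S_pj` (the weighted pairing of the profile-equation residual OF THE
SKELETON FIELD with the accretion mode of filament `j`) changes sign across face `j` with a Γ-free relative floor.  Mechanism
(M1): moving `p_j` from `0` to `1` moves the stagnation stretching `w′(c_j)` / tilt of filament `j` across the window, and the
slip of the skeleton through its stagnation section reverses orientation relative to the accretion mode; `R_π`-symmetry pairs
the two filaments' functionals (`S_p1 = S_p0` at symmetric `p`).  Why it might fail: on the `R_π` family the lane's datum
(g4, RESULTS-19174-sign.md, 20 cases at Γ = 1e4) shows import-dominated budgets with near-equal competing routes — the bare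
functional may keep ONE sign across the whole window (falsifier F2′ below: one quadrature sweep).  [folklore; instrument N7] -/
theorem stub_slipSignBL_rpiWindow : SlipSignBLWindow := by
  sorry

/-- **Stub 2b (v5: `stub_signResponseBL_rpiWindow`, S on the Burgers–Leray proxy core; size XL — the analytic stub; PDE, prefactor level, SIGN ONLY).**  For admissible
reduced families (`SignLaw`'s antecedent VERBATIM: nonzero smooth divergence-free `U_p` solving the forced profile equation with
amplitudes `B_pj`, decay `C₀/(1+‖y‖)`, bounded pressure, `‖U_p − u_X‖ ≤ η√Γ` on the window ball OFF the tubes) on window boxes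
carrying the slip pattern with floor `s₀`: `B_pj` has the sign of `S_pj` on the faces.  Mechanism (M2, sign response): testing the
forced profile equation against `D̃_pj` gives the exact identity `B_pj⟪D_pj, D̃_pj⟫ = ⟪profileOp(U_p) + ∇P_p, D̃_pj⟫ − Σ_{k≠j}
B_pk⟪D_pk, D̃_pj⟫`; the cross terms are exponentially small in the `ρ√Γ` separation; the bet is that the leading pairing has the
sign of the same pairing for the proxy core `u_X` because both are concentrated axisymmetric cores sitting in the SAME outer
field (pinned by the off-tube closeness through Biot–Savart), and the sign of the slip-induced first azimuthal harmonic does not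
depend on the core profile once `|S_pj|` clears the relative floor.  Why it might fail: (i) THE WEIGHT SITS IN THE CORE where no
closeness is imposed and the proxy core (Rosenhead, algebraic) differs from the true viscous core at O(1) relative size — if the
sign of the in-core pairing is NOT core-universal the stub is false as typed and the weight must move to an off-tube annulus,
where, however, `u_X` is nearly irrotational and `profileOp(u_X)` nearly a gradient, so the off-tube pairing degenerates to a
pressure moment (recorded: the off-tube linear response predicts `B ≈ 0` and carries the sign only at sub-leading order);
(ii) the pressure pairing `⟪∇P, D̃⟫ = −⟪P, div D̃⟫` is bounded by `M·‖div D̃‖_{L¹}`, not obviously subordinate; (iii) branch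
mixing (refuter1 g5): `U` need not be continuous in `p`, so the sign response must hold family-by-family; (iv) off-tube
`C⁰`-closeness must be upgraded to control of the outer strain at the core (interior elliptic regularity of the forced
equation whose forcing is the unknown `Σ B D` — a fixed point, not a direct estimate).
Leans on: KNSS2009, Gallay–Maekawa arXiv:1610.08384 Thm 4.3 (stability of Burgers/Lamb–Oseen cores in strain), Gallay–Smets
2020 Rem 1.4, `Cruxes/TransverseReductionRJ/Lines/kelvin_gate.lean` (the in-tube reduction this stub implicitly needs). -/
theorem stub_signResponseBL_rpiWindow : SignResponseBLWindow := by
  sorry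

/-- **The window sign law DERIVED from the typed mechanism (sorry-free): slip sign pattern ⊕ linear response ⟹
`SignLawRpiWindow`** (choose `s₀, Γ₁ᵃ` from 2a, then `η, Γ₁ᵇ` from 2b at `s₀`, `Γ₁ := Γ₁ᵃ ⊔ Γ₁ᵇ`; on the faces
`B_pj S_pj > 0`, `B_qj S_qj > 0` (2b) and `S_pj S_qj < 0` (2a) `⟹ B_pj B_qj < 0`). [folklore] -/
theorem signLawRpiWindow_of (h2a : SlipSignRpiWindow) (h2b : SignResponseRpiWindow) : SignLawRpiWindow := by
  intro δ ρ K Λ a b cnd Rw Rb cg θ₀ hδ hρ ha hcnd hRw hRb hcg hθ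
  obtain ⟨s₀, Γa, hs₀, hA⟩ := h2a δ ρ K Λ a b cnd Rw Rb cg θ₀ hδ hρ ha hcnd hRw hRb hcg hθ
  obtain ⟨η, Γb, hη, hB⟩ := h2b δ ρ K Λ a b cnd Rw Rb cg θ₀ hδ hρ ha hcnd hRw hRb hcg hθ s₀ hs₀
  refine ⟨η, max Γa Γb, hη, ?_⟩
  intro Γ hΓ γ α X w c m n hwin u v A T D hdefs hbox
  intro C₀ M U P B hAdm j p q hp hq hpj hqj
  have hpat := hA Γ ((le_max_left _ _).trans hΓ) γ α X w c m n hwin u v A T D hdefs hbox j p q hp hq hpj hqj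
  obtain ⟨hBp, hBq⟩ := hB Γ ((le_max_right _ _).trans hΓ) γ α X w c m n hwin u v A T D hdefs hbox C₀ M U P B hAdm
    j p q hp hq hpj hqj hpat
  have h1 : 0 < B p j * slip α X c u D p j := hBp
  have h2 : 0 < B q j * slip α X c u D q j := hBq
  have hS := hpat.1
  by_contra hcon
  have hcon : 0 ≤ B p j * B q j := not_lt.mp hcon
  have h3 : 0 < (B p j * slip α X c u D p j) * (B q j * slip α X c u D q j) := mul_pos h1 h2
  have h4 : (B p j * slip α X c u D p j) * (B q j * slip α X c u D q j)
      = (B p j * B q j) * (slip α X c u D p j * slip α X c u D q j) := by ring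
  rw [h4] at h3
  have h5 : (B p j * B q j) * (slip α X c u D p j * slip α X c u D q j) ≤ 0 :=
    mul_nonpos_of_nonneg_of_nonpos hcon hS.le
  exact absurd h3 (not_lt.mpr h5)

/-- v5: the same derivation on the Burgers–Leray proxy core. [folklore] -/
theorem signLawRpiWindow_ofBL (h2a : SlipSignBLWindow) (h2b : SignResponseBLWindow) : SignLawRpiWindow := by
  intro δ ρ K Λ a b cnd Rw Rb cg θ₀ hδ hρ ha hcnd hRw hRb hcg hθ
  obtain ⟨s₀, Γa, hs₀, hA⟩ := h2a δ ρ K Λ a b cnd Rw Rb cg θ₀ hδ hρ ha hcnd hRw hRb hcg hθ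
  obtain ⟨η, Γb, hη, hB⟩ := h2b δ ρ K Λ a b cnd Rw Rb cg θ₀ hδ hρ ha hcnd hRw hRb hcg hθ s₀ hs₀
  refine ⟨η, max Γa Γb, hη, ?_⟩
  intro Γ hΓ γ α X w c m n hwin u v A T D hdefs hbox
  intro C₀ M U P B hAdm j p q hp hq hpj hqj
  have hpat := hA Γ ((le_max_left _ _).trans hΓ) γ α X w c m n hwin u v A T D hdefs hbox j p q hp hq hpj hqj
  obtain ⟨hBp, hBq⟩ := hB Γ ((le_max_right _ _).trans hΓ) γ α X w c m n hwin u v A T D hdefs hbox C₀ M U P B hAdm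
    j p q hp hq hpj hqj hpat
  have h1 : 0 < B p j * slip α X c (uBL Γ γ w c) D p j := hBp
  have h2 : 0 < B q j * slip α X c (uBL Γ γ w c) D q j := hBq
  have hS := hpat.1
  by_contra hcon
  have hcon : 0 ≤ B p j * B q j := not_lt.mp hcon
  have h3 : 0 < (B p j * slip α X c (uBL Γ γ w c) D p j) * (B q j * slip α X c (uBL Γ γ w c) D q j) := mul_pos h1 h2
  have h4 : (B p j * slip α X c (uBL Γ γ w c) D p j) * (B q j * slip α X c (uBL Γ γ w c) D q j)
      = (B p j * B q j) * (slip α X c (uBL Γ γ w c) D p j * slip α X c (uBL Γ γ w c) D q j) := by ring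
  rw [h4] at h3
  have h5 : (B p j * B q j) * (slip α X c (uBL Γ γ w c) D p j * slip α X c (uBL Γ γ w c) D q j) ≤ 0 :=
    mul_nonpos_of_nonneg_of_nonpos hcon hS.le
  exact absurd h3 (not_lt.mpr h5)

/-- **Composition (pure logic).**  A window ball box, the window slip sign pattern and window linear response give
`SelectionBoxRJ` BY NAME: the sign law is DERIVED (`signLawRpiWindow_of`), then `N := 2`, the box's constants, the sign
law's `η` and `Γ₁`, and `Γ₂ ⊔ Γ₁`. [folklore] -/
theorem SelectionBoxRJ_of (h1 : BallBoxRpiWindow) (h2a : SlipSignBLWindow) (h2b : SignResponseBLWindow) :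
    Summit.NavierStokesRegularity.NavierStokesRegularity.Theses.FilamentSkeletonRss.SelectionBoxRJ := by
  have h2 : SignLawRpiWindow := signLawRpiWindow_ofBL h2a h2b
  obtain ⟨δ, ρ, K, Λ, a, b, cnd, Rw, Rb, cg, θ₀, Γ₂, hδ, hρ, ha, hcnd, hRw, hRb, hcg, hθ, hbox⟩ := h1
  obtain ⟨η, Γ₁, hη, htr⟩ := h2 δ ρ K Λ a b cnd Rw Rb cg θ₀ hδ hρ ha hcnd hRw hRb hcg hθ
  refine ⟨2, δ, ρ, K, Λ, a, b, cnd, η, Rw, Rb, cg, θ₀, max Γ₂ Γ₁, by norm_num, hδ, hρ, ha, hcnd, hη, hRw, hRb, hcg, hθ, ?_⟩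
  intro Γ hΓ
  obtain ⟨γ, α, X, w, c, m, n, hwin, hdata⟩ := hbox Γ ((le_max_left _ _).trans hΓ)
  refine ⟨γ, α, X, w, c, m, n, ?_⟩
  intro u v A T D hu hv hA hT hD
  have hd := hdata u v A T D ⟨hu, hv, hA, hT, hD⟩
  exact ⟨hd, htr Γ ((le_max_right _ _).trans hΓ) γ α X w c m n hwin u v A T D ⟨hu, hv, hA, hT, hD⟩ hd⟩

/-- The crux from the three registered stubs. -/
theorem selectionBoxRJ_from_line :
    Summit.NavierStokesRegularity.NavierStokesRegularity.Theses.FilamentSkeletonRss.SelectionBoxRJ :=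
  SelectionBoxRJ_of stub_ballBox_rpiWindow stub_slipSignBL_rpiWindow stub_signResponseBL_rpiWindow

end Summit.NavierStokesRegularity.NavierStokesRegularity.Cruxes.SelectionBoxRJ.RpiWindowSplit
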